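/-
Origin: expansion seat `planner-pub-hodgecm-pohl-g2-0`, handover 2026-08-18T03:57:00Z (`HOME/pub-hodgecm-pohl-g2/lean/Pohl2/Monomials.lean`, md5 35ea0da8, 270 lines);
landed by the gen-5 packager in gate run 20 as `HodgeCM/Proofs/Pohlmann/WeightSpan.lean` (import ^import Pohl2\.CupPow\b→import HodgeCM.Proofs.Pohlmann.CupPow ×1).
-/
/-
Copyright: pub-hodgecm formalisation cell (harness21, 2026). New file (not vendored).
Origin: HOME/pub-hodgecm-pohl-g2/lean/Pohl2/Monomials.lean — session planner-pub-hodgecm-pohl-g2-0 (unit pub-hodgecm-pohl-g2),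
part (b) `PohlmannSpan`, generation 2.  Intended final place: `HodgeCM/Proofs/Pohlmann/WeightSpan.lean`
(module `HodgeCM.Proofs.Pohlmann.WeightSpan`).  WIP imports `Pohl2.X` → their final modules.
-/
import Summits.HodgeConjecture.HodgeCM.Geometry.WeightFacts
import Summits.HodgeConjecture.HodgeCM.Proofs.Pohlmann.FactorAct
import Summits.HodgeConjecture.HodgeCM.Proofs.Prop22.Eigen
import Summits.HodgeConjecture.HodgeCM.Proofs.Pohlmann.CupPow

/-!
# Pohlmann's span theorem, IV: the eigen-monomials and the proof of M29 `Fact_weightSpan`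

For `A′ = ∏_{j ≤ n} A_{(F,Θ_j)}` we prove that the weight spaces `weightSpace F Θ S k` SPAN `H^k(A′, ℂ)`
(`HodgeCM.Universe.weightSpan_of_facts`), from `ModelAxioms` and the two textbook facts
N1 `Fact_cupExterior` (`⋀^{k+1} H¹ ≅ H^{k+1}` via cup) and N3 `Fact_pull_H0` (`f^* = id` on `H⁰`):

* `exists_eq_sum_pull_prj` — Künneth in degree one for the iterated product (M21 `kunneth1`, induction on `n`):
  every `w ∈ H¹(A′, ℚ)` is `∑_j pr_j^* v_j`;
* `fvec x (j, τ) = pr_j^* x_{j,τ}` for eigenbases `x_j = (x_{j,τ})_τ` of the `H¹(A_{Θ_j}, ℂ)` (M25–M27 via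
  `exists_eigenbasis`); they span `H¹(A′, ℂ)` (`span_fvec_eq_top`), and a factor-wise CM multiplication by `a`
  on factor `j` multiplies `fvec x (i, τ)` by `τ(a)` if `i = j` and by `1` otherwise (`pullC_fvec`);
* `fmono x k p = fvec x (p 0) ∪ ⋯ ∪ fvec x (p k)`; by N1 these span `H^{k+1}(A′, ℂ)` and vanish unless `p` is
  injective (alternation), and for injective `p` the monomial is a WEIGHT VECTOR of weight
  `wtOf k p = (j ↦ {τ | (j, τ) ∈ im p})` (`isWeightVector_fmono`, M2 `pull_cup`);
* degree `0`: every class has weight `(∅)_j` by N3.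
Reference for the mathematics: Pohlmann, Ann. of Math. 88 (1968) §1; Gao–Ullmo, arXiv:2411.12249 §3.1
(proof of Thm 3.1, the basis `e_S` of `H^•(A′, ℂ)` of `T`-eigenvectors).
-/

noncomputable section

open scoped TensorProduct NumberField Classical

namespace HodgeCM

open Literature.AlgebraicGeometry.Motives
open Literature.AlgebraicGeometry.Motives.HodgeStructure (conj ofRat)

namespace Universe

variable {U : Universe}

/-! ### Künneth in degree one for the iterated product -/

/-- Every rational degree-one class on `∏_{i ≤ n} X_i` is a sum of classes pulled back from the factors
(M21 `kunneth1` + M1 `pull_id`/`pull_comp`, induction on `n`). -/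
theorem exists_eq_sum_pull_prj (M : U.ModelAxioms) : ∀ (n : ℕ) (X : Fin (n + 1) → U.Var)
    (w : U.Coh (U.prodFin n X) 1),
    ∃ v : (i : Fin (n + 1)) → U.Coh (X i) 1, w = ∑ i, U.pull (U.prj n X i) 1 (v i)
  | 0, X, w => by
    refine ⟨Fin.cons (α := fun i => U.Coh (X i) 1) w (fun i => i.elim0), ?_⟩
    rw [Fin.sum_univ_one, Fin.cons_zero, prj_zero]
    exact (LinearMap.congr_fun (M.pull_id (X 0) 1) w).symm
  | n + 1, X, w => by
    obtain ⟨⟨w', v'⟩, h⟩ := (M.kunneth1 _ _).2 w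
    obtain ⟨v, hv⟩ := exists_eq_sum_pull_prj M n (fun i => X i.castSucc) w'
    refine ⟨Fin.snoc (α := fun i => U.Coh (X i) 1) v v', ?_⟩
    have hcs : ∀ i : Fin (n + 1),
        U.pull (U.prj (n + 1) X i.castSucc) 1 (Fin.snoc (α := fun i => U.Coh (X i) 1) v v' i.castSucc) =
          U.pull (X := U.prodFin (n + 1) X) (U.fst (U.prodFin n fun i => X i.castSucc) (X (Fin.last (n + 1)))) 1
            (U.pull (U.prj n (fun i => X i.castSucc) i) 1 (v i)) := by
      intro i
      rw [Fin.snoc_castSucc, prj_castSucc, M.pull_comp]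
      rfl
    rw [Fin.sum_univ_castSucc, Fin.snoc_last, prj_last, Finset.sum_congr rfl fun i _ => hcs i, ← map_sum, ← hv,
      ← h, LinearMap.coprod_apply]
    rfl

section CM

variable {F : CMField} {n : ℕ} {Θ : Fin (n + 1) → CMType F}

/-! ### The projections `pr_j^*` on `H¹`, typed over `cmProd` -/

variable (U) in
/-- `pr_j^* : H¹(A_{(F,Θ_j)}, ℚ) → H¹(A′, ℚ)`, with codomain typed as `Coh (cmProd F Θ) 1`
(`cmProd F Θ` is by definition `prodFin n (j ↦ A_{(F,Θ_j)})`). -/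
def prQ (F : CMField) {n : ℕ} (Θ : Fin (n + 1) → CMType F) (j : Fin (n + 1)) :
    U.Coh (U.cmAV F (Θ j)) 1 →ₗ[ℚ] U.Coh (U.cmProd F Θ) 1 :=
  U.pull (U.prj n (fun i => U.cmAV F (Θ i)) j) 1

variable (U) in
/-- `pr_j^* : H¹(A_{(F,Θ_j)}, ℂ) → H¹(A′, ℂ)` (complexified). -/
def prC (F : CMField) {n : ℕ} (Θ : Fin (n + 1) → CMType F) (j : Fin (n + 1)) :
    U.CohC (U.cmAV F (Θ j)) 1 →ₗ[ℂ] U.CohC (U.cmProd F Θ) 1 :=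
  U.pullC (U.prj n (fun i => U.cmAV F (Θ i)) j) 1

/-- (Ported verbatim from the HodgeCMPerL package; no docstring in the source.) -/
theorem prC_tmul (j : Fin (n + 1)) (c : ℂ) (y : U.Coh (U.cmAV F (Θ j)) 1) :
    U.prC F Θ j (c ⊗ₜ y) = c ⊗ₜ U.prQ F Θ j y := rfl

/-- Künneth for `A′`: every `w ∈ H¹(A′, ℚ)` is `∑_j pr_j^* v_j`. -/
theorem exists_eq_sum_prQ (M : U.ModelAxioms) (w : U.Coh (U.cmProd F Θ) 1) :
    ∃ v : (j : Fin (n + 1)) → U.Coh (U.cmAV F (Θ j)) 1, w = ∑ j, U.prQ F Θ j (v j) :=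
  exists_eq_sum_pull_prj M n (fun i => U.cmAV F (Θ i)) w

/-- A factor-wise CM multiplication by `a` on factor `j` acts on `pr_j^* H¹(A_{Θ_j}, ℂ)` through `ι(a)^*`
and trivially on `pr_i^* H¹(A_{Θ_i}, ℂ)`, `i ≠ j` (the definition `IsFactorAct`, complexified). -/
theorem pullC_prC_self {j : Fin (n + 1)} {a : F} {Ma : U.Mor (U.cmProd F Θ) (U.cmProd F Θ)}
    (hM : U.IsFactorAct F Θ j a Ma) (y : U.CohC (U.cmAV F (Θ j)) 1) :
    U.pullC Ma 1 (U.prC F Θ j y) = U.prC F Θ j (((U.cmAct F (Θ j)).ι a : _ →ₗ[ℚ] _).baseChange ℂ y) := by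
  have e1 : U.pullC Ma 1 (U.prC F Θ j y) =
      (U.prQ F Θ j ∘ₗ ((U.cmAct F (Θ j)).ι a : _ →ₗ[ℚ] _)).baseChange ℂ y :=
    baseChange_baseChange_of_comp_eq hM.1 y
  rw [e1, LinearMap.baseChange_comp]
  rfl

/-- (Ported verbatim from the HodgeCMPerL package; no docstring in the source.) -/
theorem pullC_prC_of_ne {j : Fin (n + 1)} {a : F} {Ma : U.Mor (U.cmProd F Θ) (U.cmProd F Θ)}
    (hM : U.IsFactorAct F Θ j a Ma) {i : Fin (n + 1)} (hij : i ≠ j) (y : U.CohC (U.cmAV F (Θ i)) 1) :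
    U.pullC Ma 1 (U.prC F Θ i y) = U.prC F Θ i y :=
  pullC_pullC_of_comp_eq (hM.2 i hij) y

/-! ### The pulled-back eigenclasses `fvec x (j, τ) = pr_j^* x_{j,τ}` -/

variable (U) in
/-- `fvec x (j, τ) = pr_j^* x_{j,τ} ∈ H¹(A′, ℂ)` for families `x_j : (F →+* ℂ) → H¹(A_{(F,Θ_j)}, ℂ)`. -/
def fvec (x : (j : Fin (n + 1)) → ((F : Type) →+* ℂ) → U.CohC (U.cmAV F (Θ j)) 1)
    (q : Fin (n + 1) × ((F : Type) →+* ℂ)) : U.CohC (U.cmProd F Θ) 1 :=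
  U.prC F Θ q.1 (x q.1 q.2)

variable (x : (j : Fin (n + 1)) → ((F : Type) →+* ℂ) → U.CohC (U.cmAV F (Θ j)) 1)

/-- If each `x_j` spans `H¹(A_{Θ_j}, ℂ)`, the `fvec x (j, τ)` span `H¹(A′, ℂ)` (Künneth). -/
theorem span_fvec_eq_top (M : U.ModelAxioms) (hsp : ∀ j, Submodule.span ℂ (Set.range (x j)) = ⊤) :
    Submodule.span ℂ (Set.range (U.fvec x)) = ⊤ := by
  have hi : ∀ j (t : U.CohC (U.cmAV F (Θ j)) 1), U.prC F Θ j t ∈ Submodule.span ℂ (Set.range (U.fvec x)) := by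
    intro j t
    have ht : t ∈ Submodule.span ℂ (Set.range (x j)) := by rw [hsp j]; trivial
    induction ht using Submodule.span_induction with
    | mem t ht => obtain ⟨τ, rfl⟩ := ht; exact Submodule.subset_span (Set.mem_range.mpr ⟨(j, τ), rfl⟩)
    | zero => simp
    | add t t' _ _ h h' => simpa only [map_add] using add_mem h h'
    | smul r t _ h => simpa only [map_smul] using Submodule.smul_mem _ r h
  rw [eq_top_iff]
  rintro t -
  induction t using TensorProduct.induction_on with
  | zero => exact zero_mem _
  | add t t' h h' => exact add_mem h h'
  | tmul c w =>
    have : c ⊗ₜ[ℚ] w = c • ((1 : ℂ) ⊗ₜ[ℚ] w) := by rw [TensorProduct.smul_tmul', smul_eq_mul, mul_one]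
    rw [this]
    refine Submodule.smul_mem _ c ?_
    obtain ⟨v, hv⟩ := exists_eq_sum_prQ M w
    rw [hv, TensorProduct.tmul_sum]
    refine Submodule.sum_mem _ fun i _ => ?_
    rw [← prC_tmul]
    exact hi i _

/-- A factor-wise CM multiplication by `a` on factor `j` multiplies `pr_i^* x_{i,τ}` by `τ(a)` if `i = j`
(eigenclass) and fixes it if `i ≠ j`. -/
theorem pullC_fvec (hx : ∀ j τ, x j τ ∈ U.eigenLine F (Θ j) τ) {j : Fin (n + 1)} {a : F}
    {Ma : U.Mor (U.cmProd F Θ) (U.cmProd F Θ)} (hM : U.IsFactorAct F Θ j a Ma)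
    (q : Fin (n + 1) × ((F : Type) →+* ℂ)) :
    U.pullC Ma 1 (U.fvec x q) = (if q.1 = j then (q.2 a : ℂ) else 1) • U.fvec x q := by
  obtain ⟨i, τ⟩ := q
  by_cases hij : i = j
  · subst hij
    simp only [fvec, if_true]
    rw [pullC_prC_self hM, (mem_eigenLine_iff.mp (hx i τ)) a, map_smul]
  · simp only [fvec, if_neg hij, one_smul]
    exact pullC_prC_of_ne hM hij (x i τ)

/-! ### The eigen-monomials `fmono x k p` and their weights -/

variable (U) in
/-- `fmono x k p = fvec x (p 0) ∪ ⋯ ∪ fvec x (p k) ∈ H^{k+1}(A′, ℂ)`. -/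
def fmono (k : ℕ) (p : Fin (k + 1) → Fin (n + 1) × ((F : Type) →+* ℂ)) : U.CohC (U.cmProd F Θ) (k + 1) :=
  U.cupPowC (U.cmProd F Θ) k (U.fvec x ∘ p)

omit x in
/-- The weight of the monomial indexed by `p`: `S_j = {τ | (j, τ) ∈ im p}`. -/
def wtOf (k : ℕ) (p : Fin (k + 1) → Fin (n + 1) × ((F : Type) →+* ℂ)) (j : Fin (n + 1)) :
    Finset ((F : Type) →+* ℂ) :=
  (Finset.univ.filter fun i => (p i).1 = j).image fun i => (p i).2

/-- (Ported verbatim from the HodgeCMPerL package; no docstring in the source.) -/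
theorem fmono_eq (k : ℕ) (p : Fin (k + 1) → Fin (n + 1) × ((F : Type) →+* ℂ)) :
    U.fmono x k p = U.cupPowC (U.cmProd F Θ) k (U.fvec x ∘ p) := rfl

/-- A factor-wise CM multiplication by `a` on factor `j` multiplies `fmono x k p` by
`∏_i (τ_i(a) if j_i = j else 1)`, `p i = (j_i, τ_i)` (M2 `pull_cup` + `pullC_fvec`). -/
theorem pullC_fmono (M : U.ModelAxioms) (hx : ∀ j τ, x j τ ∈ U.eigenLine F (Θ j) τ) {j : Fin (n + 1)} {a : F}
    {Ma : U.Mor (U.cmProd F Θ) (U.cmProd F Θ)} (hM : U.IsFactorAct F Θ j a Ma)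
    (k : ℕ) (p : Fin (k + 1) → Fin (n + 1) × ((F : Type) →+* ℂ)) :
    U.pullC Ma (k + 1) (U.fmono x k p) =
      (∏ i, if (p i).1 = j then ((p i).2 a : ℂ) else 1) • U.fmono x k p := by
  rw [fmono_eq, pullC_cupPowC M.pull_cup, ← cupPowC_smul]
  congr 1
  funext i
  exact pullC_fvec x hx hM (p i)

omit x in
/-- For injective `p` the eigenvalue is `∏_{s ∈ (wtOf k p) j} s(a)`. -/
theorem prod_ite_eq_prod_wtOf {k : ℕ} (p : Fin (k + 1) → Fin (n + 1) × ((F : Type) →+* ℂ))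
    (hp : Function.Injective p) (j : Fin (n + 1)) (a : F) :
    (∏ i, if (p i).1 = j then ((p i).2 a : ℂ) else 1) = ∏ s ∈ wtOf k p j, s a := by
  rw [← Finset.prod_filter, wtOf, Finset.prod_image]
  intro i hi i' hi' h
  simp only [Finset.coe_filter, Finset.mem_univ, true_and, Set.mem_setOf_eq] at hi hi'
  exact hp (Prod.ext (hi.trans hi'.symm) h)

/-- **Eigen-monomials with distinct entries are weight vectors** of weight `wtOf k p`. -/
theorem isWeightVector_fmono (M : U.ModelAxioms) (hx : ∀ j τ, x j τ ∈ U.eigenLine F (Θ j) τ) (k : ℕ)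
    (p : Fin (k + 1) → Fin (n + 1) × ((F : Type) →+* ℂ)) (hp : Function.Injective p) :
    U.IsWeightVector F Θ (wtOf k p) (k + 1) (U.fmono x k p) := by
  intro j a Ma hM
  rw [pullC_fmono x M hx hM, prod_ite_eq_prod_wtOf p hp j a]

/-- Eigen-monomials with a repeated entry vanish (alternation, from N1). -/
theorem fmono_eq_zero_of_not_injective {k : ℕ} (hE : U.CupExterior (U.cmProd F Θ) k)
    (p : Fin (k + 1) → Fin (n + 1) × ((F : Type) →+* ℂ)) (hp : ¬Function.Injective p) :
    U.fmono x k p = 0 := by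
  obtain ⟨i, l, hpe, hil⟩ := Function.not_injective_iff.mp hp
  exact cupPowC_eq_zero_of_eq hE _ hil (by simp [hpe])

/-- The eigen-monomials span `H^{k+1}(A′, ℂ)` (N1 + Künneth + multilinearity). -/
theorem span_fmono_eq_top (M : U.ModelAxioms) {k : ℕ} (hE : U.CupExterior (U.cmProd F Θ) k)
    (hsp : ∀ j, Submodule.span ℂ (Set.range (x j)) = ⊤) :
    Submodule.span ℂ (Set.range (U.fmono x k)) = ⊤ :=
  span_cupPowC_comp_eq_top (U.fvec x) hE (span_fvec_eq_top x M hsp)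

/-! ### M29 in positive degree -/

omit x in
/-- The weight spaces span `H^{k+1}(A′, ℂ)`. -/
theorem iSup_weightSpace_succ (M : U.ModelAxioms) (hN1 : U.Fact_cupExterior) (k : ℕ) :
    ⨆ S, U.weightSpace F Θ S (k + 1) = ⊤ := by
  obtain ⟨β, -, hβ⟩ := exists_integral_injective_eval F
  choose x hx _hx0 hsp using fun j => exists_eigenbasis M F (Θ j) β hβ
  rw [eq_top_iff, ← span_fmono_eq_top x M (hN1 F n Θ k) hsp, Submodule.span_le]
  rintro _ ⟨p, rfl⟩
  by_cases hp : Function.Injective p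
  · exact Submodule.mem_iSup_of_mem (wtOf k p)
      ((mem_weightSpace_iff _ _ _ _ _).2 (isWeightVector_fmono x M hx k p hp))
  · rw [fmono_eq_zero_of_not_injective x (hN1 F n Θ k) p hp]
    exact zero_mem _

/-! ### M29 in degree zero -/

omit x in
/-- On `H⁰(A′, ℂ)` every factor-wise CM multiplication acts trivially (N3), so every class has weight `(∅)_j`. -/
theorem isWeightVector_zero (hN3 : U.Fact_pull_H0) (y : U.CohC (U.cmProd F Θ) 0) :
    U.IsWeightVector F Θ (fun _ => ∅) 0 y := by
  intro j a Ma _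
  simp only [Finset.prod_empty, one_smul]
  show (U.pull Ma 0).baseChange ℂ y = y
  rw [hN3, LinearMap.baseChange_id]
  rfl

omit x in
/-- (Ported verbatim from the HodgeCMPerL package; no docstring in the source.) -/
theorem iSup_weightSpace_zero (hN3 : U.Fact_pull_H0) : ⨆ S, U.weightSpace F Θ S 0 = ⊤ :=
  eq_top_iff.2 fun y _ =>
    Submodule.mem_iSup_of_mem (fun _ => ∅) ((mem_weightSpace_iff _ _ _ _ _).2 (isWeightVector_zero hN3 y))

end CM

/-- **M29 `Fact_weightSpan` is a theorem** of `ModelAxioms` + N1 (`⋀^• H¹ = H^•` via cup) + N3 (`f^* = id` on `H⁰`):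
`H^k(A′, ℂ)` is spanned by weight vectors. -/
theorem weightSpan_of_facts (M : U.ModelAxioms) (hN1 : U.Fact_cupExterior) (hN3 : U.Fact_pull_H0) :
    U.Fact_weightSpan := by
  intro F n Θ k
  cases k with
  | zero => exact iSup_weightSpace_zero hN3
  | succ k => exact iSup_weightSpace_succ M hN1 k

end Universe

end HodgeCM

end
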